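import Mathlib.Analysis.InnerProductSpace.Spectrum
import Mathlib.Analysis.InnerProductSpace.l2Space
import Mathlib.Analysis.InnerProductSpace.Adjoint
import Mathlib.Tactic.Module
import Literature.Analysis.OperatorTheory.CompactSelfAdjointEigenbasis
import HarnessLib

/-!
# Joint Hilbert eigenbasis of a compact self-adjoint operator and a commuting self-adjoint involution
(stub `stub_jointEigenbasis_involution` of line `twisted_trace_transfer`, crux
`QuarksAsStableAction.StableActionBridge`, stmt-QuantumFields-9737; sub-goal C5 of step E3)

For a compact self-adjoint operator `A` and a self-adjoint involution `F` (`F * F = 1`) on a complex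
Hilbert space `E` with `A * F = F * A`, there is a Hilbert basis `b` of `E` with `A (b i) = λᵢ • b i`,
`F (b i) = σᵢ • b i`, `λᵢ ∈ ℝ`, `σᵢ = ±1`.  In E3, `A` is Lüscher's transfer matrix and `F` the fermion
parity `(−1)^F`; the supertrace `Σᵢ σᵢ λᵢ^N` over this basis is the time-periodic torus functional.

Proof (direct gluing, as in `Literature.Analysis.OperatorTheory.exists_hilbertBasis_eigenvectors`):
the pieces `V (μ, ε) := eigenspace A μ ⊓ eigenspace F ε` (`μ ε : ℂ`) are closed and pairwise orthogonal
(`A`, `F` symmetric: `LinearMap.IsSymmetric.orthogonalFamily_eigenspaces`); choose a Hilbert basis in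
each (`exists_hilbertBasis`) and take the union `s ⊆ E` of their images.  It is orthonormal, and the
closure of its span contains every piece, hence every eigenspace `E_μ` of `A` (each `x ∈ E_μ` splits
as `½(x + F x) + ½(x − F x) ∈ V (μ, 1) + V (μ, −1)`, using `A F = F A` and `F² = 1`), hence the closure
of `⨆ μ, E_μ`, which is everything by Mathlib's spectral theorem
`ContinuousLinearMap.orthogonalComplement_iSup_eigenspaces_eq_bot`; so `s` is a Hilbert basis
(`HilbertBasis.mk`).  On `b i ∈ V (μ, ε)`: `A (b i) = μ • b i` with `μ = conj μ` real
(`LinearMap.IsSymmetric.conj_eigenvalue_eq_self`), and `F (b i) = ε • b i` with `ε² = 1`, i.e.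
`ε = ±1` (`mul_self_eq_one_iff`).  Mathlib + the Literature closedness lemma only. [folklore]
[cite: ReedSimonI1980, Thm. VI.16]
-/

noncomputable section

open scoped InnerProductSpace ComplexConjugate
open Submodule Module.End

namespace Summit.QuantumFields.QCD.Cruxes.StableActionBridge.TwistedTraceTransfer

namespace StubJointEigenbasisInvolution

variable {E : Type*} [NormedAddCommGroup E] [InnerProductSpace ℂ E]

/-- The joint pieces `eigenspace A μ ⊓ eigenspace F ε` of two bounded operators are closed. [folklore] -/
theorem isClosed_piece (A F : E →L[ℂ] E) (p : ℂ × ℂ) :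
    IsClosed ((eigenspace (A : Module.End ℂ E) p.1 ⊓ eigenspace (F : Module.End ℂ E) p.2 : Submodule ℂ E) : Set E) := by
  rw [Submodule.coe_inf]
  exact (Literature.Analysis.OperatorTheory.isClosed_eigenspace A p.1).inter
    (Literature.Analysis.OperatorTheory.isClosed_eigenspace F p.2)

/-- Distinct joint pieces of two symmetric operators are orthogonal. [folklore] -/
theorem inner_piece_eq_zero {A F : E →L[ℂ] E} (hA : (A : E →ₗ[ℂ] E).IsSymmetric)
    (hF : (F : E →ₗ[ℂ] E).IsSymmetric) {p q : ℂ × ℂ} (hpq : p ≠ q) {x y : E}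
    (hx : x ∈ eigenspace (A : Module.End ℂ E) p.1 ⊓ eigenspace (F : Module.End ℂ E) p.2)
    (hy : y ∈ eigenspace (A : Module.End ℂ E) q.1 ⊓ eigenspace (F : Module.End ℂ E) q.2) : ⟪x, y⟫_ℂ = 0 := by
  rw [Submodule.mem_inf] at hx hy
  by_cases h1 : p.1 = q.1
  · have h2 : p.2 ≠ q.2 := fun h2 => hpq (Prod.ext h1 h2)
    exact hF.orthogonalFamily_eigenspaces h2 ⟨x, hx.2⟩ ⟨y, hy.2⟩
  · exact hA.orthogonalFamily_eigenspaces h1 ⟨x, hx.1⟩ ⟨y, hy.1⟩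

/-- Splitting of an eigenvector of `A` along an involution `F` commuting with `A`: for `x ∈ eigenspace A μ`,
`½(x + F x) ∈ eigenspace A μ ⊓ eigenspace F 1` and `½(x − F x) ∈ eigenspace A μ ⊓ eigenspace F (−1)`.
[folklore] -/
theorem half_mem_piece {A F : E →L[ℂ] E} (hFF : ∀ x, F (F x) = x) (hAF : ∀ x, A (F x) = F (A x))
    {μ : ℂ} {x : E} (hx : x ∈ eigenspace (A : Module.End ℂ E) μ) :
    (2⁻¹ : ℂ) • (x + F x) ∈ eigenspace (A : Module.End ℂ E) μ ⊓ eigenspace (F : Module.End ℂ E) 1 ∧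
      (2⁻¹ : ℂ) • (x - F x) ∈ eigenspace (A : Module.End ℂ E) μ ⊓ eigenspace (F : Module.End ℂ E) (-1) := by
  have hx' : A x = μ • x := mem_eigenspace_iff.1 hx
  have hAFx : A (F x) = μ • F x := by rw [hAF, hx', map_smul]
  simp only [Submodule.mem_inf, mem_eigenspace_iff, ContinuousLinearMap.coe_coe, map_smul, map_add,
    map_sub, hx', hAFx, hFF]
  refine ⟨⟨?_, ?_⟩, ?_, ?_⟩ <;> module

/-- `x = ½(x + F x) + ½(x − F x)`. [folklore] -/
theorem eq_half_add_half (F : E →L[ℂ] E) (x : E) :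
    x = (2⁻¹ : ℂ) • (x + F x) + (2⁻¹ : ℂ) • (x - F x) := by
  module

/-- A non-zero eigenvector of a symmetric operator has a real eigenvalue: `A x = (re μ) • x`. [folklore] -/
theorem apply_eq_re_smul {A : E →L[ℂ] E} (hA : (A : E →ₗ[ℂ] E).IsSymmetric) {μ : ℂ} {x : E}
    (hx : x ∈ eigenspace (A : Module.End ℂ E) μ) (hx0 : x ≠ 0) : A x = ((μ.re : ℝ) : ℂ) • x := by
  have hreal : conj μ = μ := hA.conj_eigenvalue_eq_self (hasEigenvalue_of_hasEigenvector ⟨hx, hx0⟩)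
  rw [Complex.conj_eq_iff_re.1 hreal]
  exact mem_eigenspace_iff.1 hx

/-- The eigenvalues of an involution (`F (F x) = x`) on non-zero eigenvectors are `1` or `−1`. [folklore] -/
theorem eigenvalue_involution {F : E →L[ℂ] E} (hFF : ∀ x, F (F x) = x) {ε : ℂ} {x : E}
    (hx : F x = ε • x) (hx0 : x ≠ 0) : ε = 1 ∨ ε = -1 := by
  have h1 : F (F x) = (ε * ε) • x := by rw [hx, map_smul, hx, smul_smul]
  rw [hFF] at h1
  have h2 : (ε * ε - 1) • x = 0 := by rw [sub_smul, one_smul, ← h1, sub_self]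
  exact mul_self_eq_one_iff.1 (sub_eq_zero.1 ((smul_eq_zero.1 h2).resolve_right hx0))

variable [CompleteSpace E]

/-- **Gluing.** For a compact symmetric `A` and a symmetric involution `F` commuting with `A` on a Hilbert
space, there is a Hilbert basis `b` of `E`, indexed by a subset `s ⊆ E` with `b i = i`, each of whose
members lies in some joint piece `eigenspace A μ ⊓ eigenspace F ε`.  [folklore] -/
theorem exists_hilbertBasis_pieces {A F : E →L[ℂ] E} (hA : (A : E →ₗ[ℂ] E).IsSymmetric)
    (hAc : IsCompactOperator A) (hF : (F : E →ₗ[ℂ] E).IsSymmetric) (hFF : ∀ x, F (F x) = x)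
    (hAF : ∀ x, A (F x) = F (A x)) :
    ∃ (s : Set E) (b : HilbertBasis s ℂ E), ⇑b = ((↑) : s → E) ∧
      ∀ i : s, ∃ p : ℂ × ℂ, (i : E) ∈ eigenspace (A : Module.End ℂ E) p.1 ⊓ eigenspace (F : Module.End ℂ E) p.2 := by
  classical
  -- adapted from `Literature.Analysis.OperatorTheory.exists_hilbertBasis_eigenvectors` (finer pieces)
  let V : ℂ × ℂ → Submodule ℂ E := fun p => eigenspace (A : Module.End ℂ E) p.1 ⊓ eigenspace (F : Module.End ℂ E) p.2
  -- a Hilbert basis `bV p` (indexed by a subset `w p`) of each piece `V p`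
  have hVb : ∀ p, ∃ (w : Set (V p)) (b : HilbertBasis w ℂ (V p)), ⇑b = ((↑) : w → V p) := fun p => by
    haveI : CompleteSpace (V p) := (isClosed_piece A F p).completeSpace_coe
    exact exists_hilbertBasis ℂ (V p)
  choose w bV hbV using hVb
  -- the candidate basis: the union of their images in `E`
  let s : Set E := ⋃ p, ((↑) : V p → E) '' (w p)
  have hmem : ∀ {x : E}, x ∈ s → ∃ p, ∃ y : V p, y ∈ w p ∧ (y : E) = x := fun hx => by
    obtain ⟨p, hp⟩ := Set.mem_iUnion.1 hx
    obtain ⟨y, hy, rfl⟩ := hp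
    exact ⟨p, y, hy, rfl⟩
  -- basis vectors of `V p` are unit vectors
  have hnorm : ∀ p, ∀ y : V p, y ∈ w p → ‖(y : E)‖ = 1 := fun p y hy => by
    have h1 := (bV p).orthonormal.1 ⟨y, hy⟩
    rw [hbV p] at h1
    simpa using h1
  -- inner products inside one piece
  have hsame : ∀ p, ∀ y y' : V p, y ∈ w p → y' ∈ w p →
      ⟪(y : E), (y' : E)⟫_ℂ = if y = y' then 1 else 0 := fun p y y' hy hy' => by
    have h := (bV p).orthonormal
    rw [hbV p, orthonormal_subtype_iff_ite] at h
    rw [← Submodule.coe_inner]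
    exact h y hy y' hy'
  -- orthonormality of `s`
  have hon : Orthonormal ℂ ((↑) : s → E) := by
    rw [orthonormal_subtype_iff_ite]
    intro v hv v' hv'
    obtain ⟨p, y, hy, rfl⟩ := hmem hv
    obtain ⟨p', y', hy', rfl⟩ := hmem hv'
    by_cases hp : p = p'
    · subst hp
      rw [hsame p y y' hy hy']
      by_cases hyy : y = y'
      · subst hyy; simp
      · have : (y : E) ≠ (y' : E) := fun h => hyy (Subtype.ext h)
        simp [hyy, this]
    · -- distinct pieces: orthogonal vectors, hence also distinct vectors
      have horth : ⟪(y : E), (y' : E)⟫_ℂ = 0 := inner_piece_eq_zero hA hF hp y.2 y'.2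
      have hne : (y : E) ≠ (y' : E) := by
        intro h
        have h0 : ⟪(y : E), (y : E)⟫_ℂ = 0 := by
          have h' := horth
          rwa [← h] at h'
        rw [inner_self_eq_zero] at h0
        have := hnorm p y hy
        rw [h0, norm_zero] at this
        exact zero_ne_one this
      simp [hne, horth]
  -- every piece lies in the closure of the span of `s`
  have hle : ∀ p, V p ≤ (span ℂ (Set.range ((↑) : s → E))).topologicalClosure := fun p => by
    have h1 : (span ℂ (Set.range (bV p))).map ((V p).subtypeL : V p →ₗ[ℂ] E) ≤
        span ℂ (Set.range ((↑) : s → E)) := by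
      rw [Submodule.map_span_le]
      rintro _ ⟨i, rfl⟩
      refine Submodule.subset_span ⟨⟨((bV p i : V p) : E), ?_⟩, rfl⟩
      refine Set.mem_iUnion.2 ⟨p, ⟨bV p i, ?_, rfl⟩⟩
      rw [hbV p]
      exact i.2
    calc V p = (⊤ : Submodule ℂ (V p)).map ((V p).subtypeL : V p →ₗ[ℂ] E) := by
          rw [Submodule.toLinearMap_subtypeL, Submodule.map_subtype_top]
      _ = (span ℂ (Set.range (bV p))).topologicalClosure.map ((V p).subtypeL : V p →ₗ[ℂ] E) := by
          rw [(bV p).dense_span]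
      _ ≤ ((span ℂ (Set.range (bV p))).map ((V p).subtypeL : V p →ₗ[ℂ] E)).topologicalClosure :=
          Submodule.topologicalClosure_map _ _
      _ ≤ _ := Submodule.topologicalClosure_mono h1
  -- totality: the closure of the span contains every eigenspace of `A`, hence everything
  have hsp : ⊤ ≤ (span ℂ (Set.range ((↑) : s → E))).topologicalClosure := by
    have hAle : ∀ μ, eigenspace (A : Module.End ℂ E) μ ≤ (span ℂ (Set.range ((↑) : s → E))).topologicalClosure := by
      intro μ x hx
      obtain ⟨h₁, h₂⟩ := half_mem_piece hFF hAF hx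
      rw [eq_half_add_half F x]
      exact add_mem (hle (μ, 1) h₁) (hle (μ, -1) h₂)
    have h2 : (⨆ μ, eigenspace (A : Module.End ℂ E) μ).topologicalClosure = ⊤ :=
      Submodule.topologicalClosure_eq_top_iff.2
        (ContinuousLinearMap.orthogonalComplement_iSup_eigenspaces_eq_bot hAc hA)
    rw [← h2]
    exact Submodule.topologicalClosure_minimal _ (iSup_le hAle) (Submodule.isClosed_topologicalClosure _)
  -- assemble
  refine ⟨s, HilbertBasis.mk hon hsp, HilbertBasis.coe_mk hon hsp, fun i => ?_⟩
  obtain ⟨p, y, _, hyi⟩ := hmem i.2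
  refine ⟨p, ?_⟩
  rw [← hyi]
  exact y.2

end StubJointEigenbasisInvolution

open StubJointEigenbasisInvolution in
/-- **Sub-goal C5 of E3 (abstract): a compact self-adjoint operator commuting with a self-adjoint involution has
a Hilbert basis of joint eigenvectors** (`A bᵢ = λᵢ bᵢ`, `F bᵢ = σᵢ bᵢ`, `λᵢ ∈ ℝ`, `σᵢ = ±1`): every eigenspace of
`A` (including `ker A`; all closed and `F`-invariant) splits as `(E_λ)₊ ⊕ (E_λ)₋` under `v = ½(v + Fv) + ½(v − Fv)`;
the family `E_λ ⊓ ker(F ∓ 1)` is orthogonal with dense span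
(Mathlib `ContinuousLinearMap.orthogonalComplement_iSup_eigenspaces_eq_bot`); glue Hilbert bases of the pieces as in
`Literature.Analysis.OperatorTheory.exists_hilbertBasis_eigenvectors`.  In E3, `F` = fermion parity.
[cite: ReedSimonI1980, Thm. VI.16] -/
theorem stub_jointEigenbasis_involution : ∀ (E : Type) [NormedAddCommGroup E] [InnerProductSpace ℂ E] [CompleteSpace E]
    (A F : E →L[ℂ] E), IsSelfAdjoint A → IsCompactOperator A → IsSelfAdjoint F → F * F = 1 → A * F = F * A →
    ∃ (ι : Type) (b : HilbertBasis ι ℂ E) (lam σ : ι → ℝ),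
      (∀ i, A (b i) = (lam i : ℂ) • b i) ∧ (∀ i, F (b i) = (σ i : ℂ) • b i) ∧ ∀ i, σ i = 1 ∨ σ i = -1 := by
  intro E _ _ _ A F hA hAc hF hFF hAF
  classical
  have hFF' : ∀ x, F (F x) = x := fun x => by
    have h := congrArg (fun T : E →L[ℂ] E => T x) hFF
    simpa using h
  have hAF' : ∀ x, A (F x) = F (A x) := fun x => by
    have h := congrArg (fun T : E →L[ℂ] E => T x) hAF
    simpa using h
  obtain ⟨s, b, hb, hs⟩ := exists_hilbertBasis_pieces hA.isSymmetric hAc hF.isSymmetric hFF' hAF'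
  choose p hp using hs
  -- the basis vectors are non-zero (unit vectors)
  have hi0 : ∀ i : s, (i : E) ≠ 0 := fun i => by
    have h := b.orthonormal.1 i
    rw [hb] at h
    intro h0
    rw [h0, norm_zero] at h
    exact zero_ne_one h
  have hFi : ∀ i : s, F i = (p i).2 • (i : E) := fun i =>
    mem_eigenspace_iff.1 (Submodule.mem_inf.1 (hp i)).2
  have hε : ∀ i : s, (p i).2 = 1 ∨ (p i).2 = -1 := fun i =>
    eigenvalue_involution hFF' (hFi i) (hi0 i)
  refine ⟨s, b, fun i => (p i).1.re, fun i => if (p i).2 = 1 then 1 else -1, fun i => ?_, fun i => ?_,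
    fun i => ?_⟩
  · dsimp only
    rw [hb]
    exact apply_eq_re_smul hA.isSymmetric (Submodule.mem_inf.1 (hp i)).1 (hi0 i)
  · dsimp only
    rw [hb, hFi i]
    rcases hε i with h | h
    · rw [h, if_pos rfl, Complex.ofReal_one]
    · rw [h, if_neg (by norm_num), Complex.ofReal_neg, Complex.ofReal_one]
  · dsimp only
    by_cases h : (p i).2 = 1
    · exact Or.inl (if_pos h)
    · exact Or.inr (if_neg h)

end Summit.QuantumFields.QCD.Cruxes.StableActionBridge.TwistedTraceTransfer

end
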